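import Summits.BirchSwinnertonDyer.Rank1Residual.X11b.Three.ImageSah
import Literature.NumberTheory.EllipticCurves.ComplexMultiplicationCoatesWilesSahProofs
import HarnessLib

/-!
# X11b at `p = 3` (team N8/O2), sub-target S7 · IMG3b, supplement: Sah's lemma with the central
# element `−1` in GENERAL RANK and over a GENERAL RING — `−1 ∈ G ≤ GL_n(R)`, `2 ∈ R^×` ⇒ every
# crossed homomorphism `G → R^n` is principal, `(R^n)^G = 0`, `H¹(G, R^n) = 0` (Mathlib `H1` of the
# standard representation); the action-level form for any `G`-module with `2` invertible

HONEST FRAMING (cell `b2b-bsdres`, run/shared/lean/b2b/bsd-rank1-residual/, verbatim in every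
file): the goal of the cell is to DELETE the COMBINATION-SHAPED residual classes of the
Birch–Swinnerton-Dyer formula for ALL analytic-rank `≤ 1` elliptic curves over `ℚ` — "full BSD
formula for every rank `≤ 1` curve in class `C`" assembled STRICTLY from published theorems — so
that the rank-`≤ 1` remainder becomes exactly the CONSTRUCTION-SHAPED classes, which are TYPED
(missing-input `Prop`s), NOT attempted. This is not "finishing BSD". Team N8/O2 = `x11b3` (X11b at
`p = 3`), seat `b2b-bsdres-x11b3-p7` (generation 2), sub-target S7 · IMG3b of `cells/x11b3/PLAN.md`.
Pure algebra; nothing specific to elliptic curves; no class or sub-population claim; nothing is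
booked; no label changes. THEOREMS ONLY (no definition, no named fact, no `sorry`).

## What this file is (process note)

This is the RE-LAND of the bounced proposal p249986 (referee of record R133.1 → R135.1, team lead
LEAD DEAL #6 A6.2 (5)). p249986 targeted `X11b/Three/ImageSah.lean`, where seat `x11b3-p1`'s file
had landed first (p249883); a whole-file proposal at that path would have removed p1's ten
`Sah.*` / `GL2.*` declarations and was bounced `append-only`. The re-land is filed as a NEW leaf
module instead of an append: p1's `ImageSah.lean` is untouched (its ten declarations stay declared
byte-identically and none of its importers is rebuilt), and only the content of p249986 that is NOT
already in the tree is kept: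

* dropped as duplicates of the tree — `subsingleton_H1_of_central_neg` /
  `eq_zero_of_invariant_of_central_neg` (= `Sah.isZero_H1_of_eq_neg_one` /
  `Sah.eq_zero_of_fixed_of_eq_neg_one` of `ImageSah.lean`), `ZMod.isUnit_two_pow_three`
  (= `GL2.isUnit_two_zmod_three_pow`), and the rank-`2`, `ℤ/3^m` matrix rows (= `GL2.*`);
* kept (this file) — §1 the ACTION-LEVEL form for any group `G` acting on an `R`-module `M`
  (`DistribMulAction`, no `Representation` packaging; the currency of the tree's Sah file
  `Literature/…/ComplexMultiplicationCoatesWilesSahProofs.lean`, from which it is derived — nothing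
  re-proved): a central `z` acting as `−1` with `2 ∈ R^×` ⇒ `x ↦ z • x − x` bijective, every
  `1`-cocycle is a `1`-coboundary (`groupCohomology.IsCocycle₁ → IsCoboundary₁`), `M^G = 0`;
  §2 the MATRIX rows in general rank `n` over a general commutative ring `R` with `2 ∈ R^×`
  (`GLn.*`: no `G`-fixed vector, every crossed homomorphism `G → R^n` principal), and their
  `ℤ/3^m` specialisations in any rank (the rank-`2` case is p1's `GL2.*`);
  §3 `H¹ = 0` for Mathlib's `groupCohomology.H1` of the STANDARD representation
  `G ↪ GL_n(R) → GL(R^n) → End(R^n)` of a matrix group containing `−1` (`Subsingleton` and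
  `IsZero` forms), any rank, any `R` with `2 ∈ R^×`, and over `ℤ/3^m`.

## Why the team keeps these rows (PLAN §1 "p = 3-ONLY phenomena", §2 S7; LINE-K K4)

At `p = 3` the coprime-order shortcut "`p ∤ #G` ⇒ `H¹(G, E[p]) = 0`" dies (`3 ∣ #GL₂(𝔽₃)`); the
substitute is Sah's lemma with the central element `−1` of the image. The rank-`2` rows serve
`E[3^m] ≅ (ℤ/3^m)²`; the general-rank rows serve the same argument for `T/3^m T` of a higher-rank
lattice `T` (products / restriction of scalars `Res_{K/ℚ}`, `E[3^m] ⊕ E[3^m]` in the Kolyvagin-system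
formalism) and for coefficient rings `𝓞/3^m 𝓞` — wherever a consumer meets "`−1` in the image,
`2` a unit". No claim is made here about WHEN `−1` lies in the image (that is `ImageNegOne.lean`,
`ImageNegOneLift.lean`, `GaloisImageNegOne.lean`, `CommutatorDescentNegOne.lean`).

References: C.-H. Sah, *Automorphisms of finite groups*, J. Algebra 10 (1968) 47–68, Prop. 2.7 (b)
and its proof (the tree's `CoatesWiles1977.isCoboundary₁_of_mem_center_of_bijective`,
`…subsingleton_H1_of_mem_center_of_bijective`); S. Lang, *Elliptic curves: Diophantine analysis*
(Sah's lemma in this form); B. Howard, Compositio 140 (2004) §1.1 (where `p ∤ #G`-type hypotheses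
enter); team files `cells/x11b3/PLAN.md` §2 S7, `cells/x11b3/LINE-K.md` K4.
-/

universe u

namespace Summit.BirchSwinnertonDyer.Rank1Residual.X11b.Three

open groupCohomology CategoryTheory
open Literature.NumberTheory.EllipticCurves

/-! ### §1 Action level: a central element acting as `−1`, `2` invertible -/

section SMulOnly

variable {R : Type*} [CommRing R] {G M : Type*} [AddCommGroup M] [Module R M] [SMul G M]

/-- If `z` acts on `x` both as `−x` and as `x`, and `2` is invertible in the coefficient ring, then
`x = 0` (`x = −x` ⇒ `2 • x = 0`). [folklore] -/
theorem eq_zero_of_smul_eq_self_of_smul_eq_neg (h2 : IsUnit (2 : R)) {z : G} {x : M}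
    (hneg : z • x = -x) (hfix : z • x = x) : x = 0 := by
  have hx : x = -x := hfix.symm.trans hneg
  have h2x : (2 : R) • x = 0 := by
    rw [two_smul]
    nth_rewrite 2 [hx]
    exact add_neg_cancel x
  obtain ⟨u, hu⟩ := h2
  calc x = ((↑u⁻¹ : R) * ↑u) • x := by rw [Units.inv_mul, one_smul]
    _ = 0 := by rw [mul_smul, hu, h2x, smul_zero]

/-- **No invariants.** If some `z ∈ G` acts as `−1` on `M` and `2 ∈ R^×`, then `M^G = 0`: a vector
fixed by every element of `G` (indeed by `z` alone) is `0`. [folklore] -/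
theorem eq_zero_of_forall_smul_eq_of_smul_eq_neg (h2 : IsUnit (2 : R)) {z : G}
    (hneg : ∀ x : M, z • x = -x) {x : M} (hfix : ∀ g : G, g • x = x) : x = 0 :=
  eq_zero_of_smul_eq_self_of_smul_eq_neg h2 (hneg x) (hfix z)

end SMulOnly

section Action

variable {R : Type*} [CommRing R] {G M : Type*} [Group G] [AddCommGroup M] [Module R M]
  [DistribMulAction G M]

/-- If `z` acts as `−1` on `M` and `2 ∈ R^×`, then `x ↦ z • x − x` (= `−2·x`) is a bijection of
`M` — i.e. "`ρ(z) − 1` is invertible", the hypothesis of Sah's lemma. Derived from the tree's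
`CoatesWiles1977.bijective_smul_sub_of_smul_eq_smul` with the scalar `c = −1`. [folklore] -/
theorem bijective_smul_sub_of_smul_eq_neg (h2 : IsUnit (2 : R)) {z : G}
    (hneg : ∀ x : M, z • x = -x) : Function.Bijective fun x : M => z • x - x :=
  CoatesWiles1977.bijective_smul_sub_of_smul_eq_smul (c := (-1 : R))
    (fun x => by rw [hneg x, neg_one_smul])
    (by rw [show (-1 : R) - 1 = -2 by norm_num]; exact h2.neg)

/-- **Sah's lemma with the central element `−1`, cocycle form.** If `z ∈ Z(G)` acts as `−1` on
the `G`-module `M` and `2 ∈ R^×`, then every `1`-cocycle `f : G → M` (`f (gh) = g • f h + f g`) is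
a `1`-coboundary (`f g = g • x − x`): `H¹(G, M) = 0`. This is the `p = 3` substitute for the
coprime-order vanishing "`p ∤ #G`" (take `R = ℤ/3^m`, `M = E[3^m]`, `z ↦ −1`). Derived from the
tree's `CoatesWiles1977.isCoboundary₁_of_mem_center_of_bijective` (Sah 1968, Prop. 2.7 (b)).
[cite: Sah1968, Prop. 2.7 (b) and its proof, p. 60] -/
theorem isCoboundary₁_of_central_neg (h2 : IsUnit (2 : R)) {z : G} (hz : z ∈ Subgroup.center G)
    (hneg : ∀ x : M, z • x = -x) {f : G → M} (hf : IsCocycle₁ f) : IsCoboundary₁ f :=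
  CoatesWiles1977.isCoboundary₁_of_mem_center_of_bijective hz
    (bijective_smul_sub_of_smul_eq_neg h2 hneg) hf

end Action

/-! ### §2 Matrix groups of any rank containing `−1`, over a ring with `2` invertible -/

namespace GLn

open Matrix

section AnyRing

variable {n : Type*} [Fintype n] [DecidableEq n] {R : Type*} [CommRing R]

/-- `−1 ∈ GL_n(R)` acts on `R^n` as `v ↦ −v`. [folklore] -/
theorem neg_one_mulVec (v : n → R) : ((-1 : GL n R) : Matrix n n R) *ᵥ v = -v := by
  rw [Units.val_neg, Units.val_one, Matrix.neg_mulVec, Matrix.one_mulVec]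

/-- `−1` is central in `GL_n(R)`: for a subgroup `G ∋ −1` and `g ∈ G`, `g · (−1) = (−1) · g` in `G`.
[folklore] -/
theorem mul_negOne_comm (G : Subgroup (GL n R)) (hG : (-1 : GL n R) ∈ G) (g : G) :
    g * ⟨-1, hG⟩ = ⟨-1, hG⟩ * g := by
  apply Subtype.ext
  change (g : GL n R) * (-1) = (-1) * (g : GL n R)
  rw [mul_neg_one, neg_one_mul]

/-- The standard representation `G ↪ GL_n(R) ≃ GL(R^n) → End_R(R^n)` of a subgroup
`G ≤ GL_n(R)` acts by `g ↦ (v ↦ g *ᵥ v)`. [folklore] -/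
theorem stdRep_apply (G : Subgroup (GL n R)) (g : G) (v : n → R) :
    (((Units.coeHom ((n → R) →ₗ[R] (n → R))).comp
      Matrix.GeneralLinearGroup.toLin.toMonoidHom).comp G.subtype) g v =
      ((g : GL n R) : Matrix n n R) *ᵥ v :=
  rfl

/-- In the standard representation, the element `−1 ∈ G` acts as the endomorphism `−1`.
[folklore] -/
theorem stdRep_negOne (G : Subgroup (GL n R)) (hG : (-1 : GL n R) ∈ G) :
    (((Units.coeHom ((n → R) →ₗ[R] (n → R))).comp
      Matrix.GeneralLinearGroup.toLin.toMonoidHom).comp G.subtype) ⟨-1, hG⟩ = -1 := by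
  apply LinearMap.ext
  intro v
  rw [stdRep_apply, LinearMap.neg_apply, Module.End.one_apply]
  exact neg_one_mulVec v

/-- **No fixed vectors** (any rank, any `R` with `2 ∈ R^×`): if `−1 ∈ G ≤ GL_n(R)` then a vector
of `R^n` fixed by every element of `G` is `0` (already `(−1)·v = v` forces `2v = 0`). [folklore] -/
theorem eq_zero_of_forall_mulVec_eq_of_neg_one_mem (h2 : IsUnit (2 : R))
    (G : Subgroup (GL n R)) (hG : (-1 : GL n R) ∈ G) {v : n → R}
    (hfix : ∀ g ∈ G, ((g : GL n R) : Matrix n n R) *ᵥ v = v) : v = 0 := by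
  have h : -v = v := by
    rw [← neg_one_mulVec v]
    exact hfix (-1) hG
  have h2v : (2 : R) • v = 0 := by
    rw [two_smul]
    nth_rewrite 1 [← h]
    exact neg_add_cancel v
  obtain ⟨w, hw⟩ := h2
  calc v = ((↑w⁻¹ : R) * ↑w) • v := by rw [Units.inv_mul, one_smul]
    _ = 0 := by rw [mul_smul, hw, h2v, smul_zero]

/-- **Every crossed homomorphism is principal** (any rank, any `R` with `2 ∈ R^×`): if
`−1 ∈ G ≤ GL_n(R)` then every `f : G → R^n` with `f (gh) = g · f h + f g` is of the form
`f g = g · v − v` — i.e. `H¹(G, R^n) = 0` — by Sah's lemma with the central element `−1`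
(`ρ(−1) − 1 = −2` is invertible): comparing `f (g·(−1))` with `f ((−1)·g)` gives
`2 f g = f(−1) − g · f(−1)`, so `v = −2⁻¹ f(−1)` works. Direct computation (no `Representation`
packaging, so `n` and `R` may live in different universes; the rank-`2`, `ℤ/3^m` case is p1's
`GL2.exists_eq_mulVec_sub_of_crossedHom`). [cite: Sah1968, Prop. 2.7 (b) and its proof, p. 60] -/
theorem exists_mulVec_sub_eq_of_crossedHom_of_neg_one_mem (h2 : IsUnit (2 : R))
    (G : Subgroup (GL n R)) (hG : (-1 : GL n R) ∈ G) (f : G → (n → R))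
    (hf : ∀ g h : G, f (g * h) = ((g : GL n R) : Matrix n n R) *ᵥ f h + f g) :
    ∃ v : n → R, ∀ g : G, ((g : GL n R) : Matrix n n R) *ᵥ v - v = f g := by
  obtain ⟨u, hu⟩ := h2
  -- `z = −1 ∈ G` acts as `−1`
  have hzv : ∀ w : n → R, (((⟨-1, hG⟩ : G) : GL n R) : Matrix n n R) *ᵥ w = -w :=
    fun w => neg_one_mulVec w
  -- Sah's identity: comparing `f (g z)` and `f (z g)` gives `2 f g = f z − g · f z`
  have hkey : ∀ g : G, f g + f g =
      f ⟨-1, hG⟩ - ((g : GL n R) : Matrix n n R) *ᵥ f ⟨-1, hG⟩ := fun g => by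
    have h1 := hf g ⟨-1, hG⟩
    have h2' := hf ⟨-1, hG⟩ g
    rw [mul_negOne_comm G hG g] at h1
    rw [hzv] at h2'
    have h := h1.symm.trans h2'
    calc f g + f g = (((g : GL n R) : Matrix n n R) *ᵥ f ⟨-1, hG⟩ + f g) + f g
          - ((g : GL n R) : Matrix n n R) *ᵥ f ⟨-1, hG⟩ := by abel
      _ = (-f g + f ⟨-1, hG⟩) + f g - ((g : GL n R) : Matrix n n R) *ᵥ f ⟨-1, hG⟩ := by rw [h]
      _ = f ⟨-1, hG⟩ - ((g : GL n R) : Matrix n n R) *ᵥ f ⟨-1, hG⟩ := by abel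
  -- the principal vector `v = −2⁻¹ · f z`
  refine ⟨-((↑u⁻¹ : R) • f ⟨-1, hG⟩), fun g => ?_⟩
  rw [Matrix.mulVec_neg, Matrix.mulVec_smul, sub_neg_eq_add]
  calc -((↑u⁻¹ : R) • (((g : GL n R) : Matrix n n R) *ᵥ f ⟨-1, hG⟩)) + (↑u⁻¹ : R) • f ⟨-1, hG⟩
      = (↑u⁻¹ : R) • (f ⟨-1, hG⟩ - ((g : GL n R) : Matrix n n R) *ᵥ f ⟨-1, hG⟩) := by
        rw [smul_sub]; abel
    _ = (↑u⁻¹ : R) • ((2 : R) • f g) := by rw [← hkey g, two_smul]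
    _ = f g := by rw [← mul_smul, ← hu, Units.inv_mul, one_smul]

end AnyRing

section ThreePow

variable {n : Type*} [Fintype n] [DecidableEq n] (m : ℕ)

/-- **No fixed vectors in `(ℤ/3^m)^n`**: if `−1 ∈ G ≤ GL_n(ℤ/3^m)` then `((ℤ/3^m)^n)^G = 0`
(any rank `n`, any `m`; `2 ∈ (ℤ/3^m)^×`). The rank-`2` case is `GL2.eq_zero_of_forall_mulVec_eq`.
[folklore] -/
theorem eq_zero_of_forall_mulVec_eq_of_neg_one_mem_zmod_three_pow
    (G : Subgroup (GL n (ZMod (3 ^ m)))) (hG : (-1 : GL n (ZMod (3 ^ m))) ∈ G)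
    {v : n → ZMod (3 ^ m)}
    (hfix : ∀ g ∈ G, ((g : GL n (ZMod (3 ^ m))) : Matrix n n (ZMod (3 ^ m))) *ᵥ v = v) :
    v = 0 :=
  eq_zero_of_forall_mulVec_eq_of_neg_one_mem (GL2.isUnit_two_zmod_three_pow m) G hG hfix

/-- **Crossed homomorphisms `G → (ℤ/3^m)^n` are principal** — `H¹(G, (ℤ/3^m)^n) = 0` — whenever
`−1 ∈ G ≤ GL_n(ℤ/3^m)` (any rank `n`, any `m`). The rank-`2` case is
`GL2.exists_eq_mulVec_sub_of_crossedHom`. [cite: Sah1968, Prop. 2.7 (b) and its proof, p. 60] -/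
theorem exists_mulVec_sub_eq_of_crossedHom_of_neg_one_mem_zmod_three_pow
    (G : Subgroup (GL n (ZMod (3 ^ m)))) (hG : (-1 : GL n (ZMod (3 ^ m))) ∈ G)
    (f : G → (n → ZMod (3 ^ m)))
    (hf : ∀ g h : G, f (g * h) =
      ((g : GL n (ZMod (3 ^ m))) : Matrix n n (ZMod (3 ^ m))) *ᵥ f h + f g) :
    ∃ v : n → ZMod (3 ^ m), ∀ g : G,
      ((g : GL n (ZMod (3 ^ m))) : Matrix n n (ZMod (3 ^ m))) *ᵥ v - v = f g :=
  exists_mulVec_sub_eq_of_crossedHom_of_neg_one_mem (GL2.isUnit_two_zmod_three_pow m) G hG f hf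

end ThreePow

/-! ### §3 `H¹ = 0` for Mathlib's `groupCohomology.H1` of the standard representation -/

section H1

variable {n : Type u} [Fintype n] [DecidableEq n] {R : Type u} [CommRing R]

/-- **`H¹(G, R^n) = 0` (Mathlib `H1`, `Subsingleton` form)** for the standard representation of a
matrix group `G ≤ GL_n(R)` containing `−1`, over any commutative ring with `2 ∈ R^×`: Sah's lemma
with the central element `−1` (`Sah.cocycles₁_le_coboundaries₁_of_isUnit` of `ImageSah.lean`).
[cite: Sah1968, Prop. 2.7 (b) and its proof, p. 60] -/
theorem subsingleton_H1_of_neg_one_mem (h2 : IsUnit (2 : R)) (G : Subgroup (GL n R))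
    (hG : (-1 : GL n R) ∈ G) :
    Subsingleton (H1 (Rep.of (((Units.coeHom ((n → R) →ₗ[R] (n → R))).comp
      Matrix.GeneralLinearGroup.toLin.toMonoidHom).comp G.subtype))) := by
  set ρ : Representation R G (n → R) := ((Units.coeHom ((n → R) →ₗ[R] (n → R))).comp
      Matrix.GeneralLinearGroup.toLin.toMonoidHom).comp G.subtype with hρdef
  have hneg : (Rep.of ρ).ρ (⟨-1, hG⟩ : G) = -1 := by
    rw [Rep.of_ρ, hρdef]
    exact stdRep_negOne G hG
  have hle := Sah.cocycles₁_le_coboundaries₁_of_isUnit (Rep.of ρ) (⟨-1, hG⟩ : G)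
    (mul_negOne_comm G hG) (Sah.isUnit_rho_sub_one_of_eq_neg_one (Rep.of ρ) _ hneg h2)
  exact subsingleton_of_forall_eq 0 fun x ↦
    H1_induction_on x fun c ↦ (H1π_eq_zero_iff c).mpr (hle c.2)

/-- **`H¹(G, R^n) = 0` (Mathlib `H1`, `IsZero` form)** for the standard representation of a matrix
group `G ≤ GL_n(R)` containing `−1`, `2 ∈ R^×` (`Sah.isZero_H1_of_eq_neg_one` of `ImageSah.lean`
applied to the standard representation). [cite: Sah1968, Prop. 2.7 (b) and its proof, p. 60] -/
theorem isZero_H1_of_neg_one_mem (h2 : IsUnit (2 : R)) (G : Subgroup (GL n R))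
    (hG : (-1 : GL n R) ∈ G) :
    Limits.IsZero (H1 (Rep.of (((Units.coeHom ((n → R) →ₗ[R] (n → R))).comp
      Matrix.GeneralLinearGroup.toLin.toMonoidHom).comp G.subtype))) := by
  set ρ : Representation R G (n → R) := ((Units.coeHom ((n → R) →ₗ[R] (n → R))).comp
      Matrix.GeneralLinearGroup.toLin.toMonoidHom).comp G.subtype with hρdef
  refine Sah.isZero_H1_of_eq_neg_one (Rep.of ρ) (⟨-1, hG⟩ : G) (mul_negOne_comm G hG) ?_ h2
  rw [Rep.of_ρ, hρdef]
  exact stdRep_negOne G hG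

end H1

section H1ThreePow

variable {n : Type} [Fintype n] [DecidableEq n] (m : ℕ)

/-- **`H¹(G, (ℤ/3^m)^n) = 0`** (Mathlib `H1` of the standard representation, `Subsingleton` form)
for every `G ≤ GL_n(ℤ/3^m)` containing `−1`, any rank `n`, any `m`.
[cite: Sah1968, Prop. 2.7 (b) and its proof, p. 60] -/
theorem subsingleton_H1_of_neg_one_mem_zmod_three_pow (G : Subgroup (GL n (ZMod (3 ^ m))))
    (hG : (-1 : GL n (ZMod (3 ^ m))) ∈ G) :
    Subsingleton (H1 (Rep.of (((Units.coeHom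
      ((n → ZMod (3 ^ m)) →ₗ[ZMod (3 ^ m)] (n → ZMod (3 ^ m)))).comp
      Matrix.GeneralLinearGroup.toLin.toMonoidHom).comp G.subtype))) :=
  subsingleton_H1_of_neg_one_mem (GL2.isUnit_two_zmod_three_pow m) G hG

/-- **`H¹(G, (ℤ/3^m)^n) = 0`** (`IsZero` form) for every `G ≤ GL_n(ℤ/3^m)` containing `−1`.
[cite: Sah1968, Prop. 2.7 (b) and its proof, p. 60] -/
theorem isZero_H1_of_neg_one_mem_zmod_three_pow (G : Subgroup (GL n (ZMod (3 ^ m))))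
    (hG : (-1 : GL n (ZMod (3 ^ m))) ∈ G) :
    Limits.IsZero (H1 (Rep.of (((Units.coeHom
      ((n → ZMod (3 ^ m)) →ₗ[ZMod (3 ^ m)] (n → ZMod (3 ^ m)))).comp
      Matrix.GeneralLinearGroup.toLin.toMonoidHom).comp G.subtype))) :=
  isZero_H1_of_neg_one_mem (GL2.isUnit_two_zmod_three_pow m) G hG

end H1ThreePow

end GLn

end Summit.BirchSwinnertonDyer.Rank1Residual.X11b.Three
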